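import Mathlib
import HarnessLib
import Summits.AtomisticToContinuum.FouriersLaw.Theorems.VanishingNoiseTransferNoisyFourierThomsonWitnessLiouvillian
import Summits.AtomisticToContinuum.FouriersLaw.Theorems.VanishingNoiseTransferNoisyFourierThomsonWitnessParity

/-!
# The Thomson witness of the velocity-flip pinned chain, III: the Liouvillian decomposition and the pattern identity
(`--supports` file for crux `VanishingNoiseTransfer.NoisyFourier`, stmt-AtomisticToContinuum-11977, line
`abel-storage-decay`, stub B `stub_bulkAbelGKPositivity`; part W3 "WitnessAlgebra", file 3 of 4)

With `v` the Thomson witness (files I–II: `…ThomsonWitnessBlocks`, `…ThomsonWitnessLiouvillian`; written inline,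
no definitions), `X = OscillatorChain.liouvillian` the Hamiltonian vector field of `pinnedChain ω₂ lam β γ` and
`P₀ f (x) = 2^{-L} Σ_{σ ∈ {0,1}^L} f (x.1, (±_σ x.2))` the momentum sign-pattern average:
* `sum_bond_sub_telescope` — `Σ_i Σ_{j = i+1} (a_i − a_j) = a_0 − a_{L−1}`;
* `liouvillian_thomsonWitness` — **(e) THE DECOMPOSITION** `X v = (p_0² − p_{L−1}²) + Σ_{bonds} (p_i R_A + p_j R_B)`
  pointwise for `L ≥ 2`, `β ≥ 0` (`X = {H, ·}`, linearity over the bonds, `poisson_bond` of file II, telescoping),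
  with the explicit `R_A` (free of `p_i`) and `R_B` (free of `p_j`): `restA_update_snd`, `restB_update_snd`;
* `patternAvg_liouvillian_thomsonWitness` — **(f) THE PATTERN IDENTITY** `P₀ (X v) = p_0² − p_{L−1}²`: the bath term
  is even in every momentum and `P₀ (p_m g) = 0` for `g` independent of `p_m` (W2's `…ThomsonWitnessParity`).
* for file IV: `∂_{p_m}` of finite sums (`partialP_finset_sum`), of the guarded bond term (`partialP_bond_ite`), and
  the Kronecker collapse of the bond sum of `∂_{p_m} (p_i G + p_j G')` (`sum_bond_partialP_collapse`).
Registered: `helper_thomsonWitnessLiouvillian`, `helper_thomsonWitnessPatternAvgLiouvillian`. All statements are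
[folklore] calculus; axioms `propext`, `Classical.choice`, `Quot.sound` only.
-/

noncomputable section

open MeasureTheory Filter Topology
open scoped BigOperators ContDiff
open Literature.MathematicalPhysics.KineticTheory.HeatConduction
open Summit.AtomisticToContinuum.FouriersLaw.Theorems.NoisyFourier.ThomsonWitness.Parity
  (patternAvg_add patternAvg_eq_self_of_forall_even patternAvg_finset_sum patternAvg_snd_mul_eq_zero_of_indep
    momentumFlip_snd_sq)

namespace Summit.AtomisticToContinuum.FouriersLaw.Theorems.NoisyFourier.ThomsonWitness.Algebra

variable {L : ℕ} {ω₂ lam β γ : ℝ}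

/-! ### Summing over the bonds: telescoping and the Liouvillian decomposition -/

/-- Telescoping over the bonds: `Σ_i Σ_{j = i+1} (a_i − a_j) = a_0 − a_{L−1}` (`L ≥ 1`). [folklore] -/
theorem sum_bond_sub_telescope (hL : 1 ≤ L) (a : Fin L → ℝ) :
    ∑ i : Fin L, ∑ j : Fin L, (if j.val = i.val + 1 then a i - a j else 0) =
      a ⟨0, by omega⟩ - a ⟨L - 1, by omega⟩ := by
  obtain ⟨M, rfl⟩ : ∃ M, L = M + 1 := ⟨L - 1, by omega⟩
  have e0 : (⟨0, by omega⟩ : Fin (M + 1)) = 0 := rfl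
  have eM : (⟨M + 1 - 1, by omega⟩ : Fin (M + 1)) = Fin.last M := Fin.ext (by simp)
  rw [e0, eM, Fin.sum_univ_castSucc]
  have hlast : (∑ j : Fin (M + 1), if j.val = (Fin.last M).val + 1 then a (Fin.last M) - a j else 0) = 0 :=
    Finset.sum_eq_zero fun j _ => by
      rw [if_neg]
      simp only [Fin.val_last]
      have := j.isLt
      omega
  have hcs : ∀ i : Fin M, (∑ j : Fin (M + 1),
      if j.val = (Fin.castSucc i).val + 1 then a (Fin.castSucc i) - a j else 0) =
      a (Fin.castSucc i) - a (Fin.succ i) := by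
    intro i
    rw [Finset.sum_eq_single (Fin.succ i), if_pos (by simp)]
    · intro j _ hj
      rw [if_neg]
      intro e
      apply hj
      ext
      simp only [Fin.val_castSucc] at e
      simp [e]
    · intro h
      exact absurd (Finset.mem_univ _) h
  rw [hlast, add_zero, Finset.sum_congr rfl fun i _ => hcs i, Finset.sum_sub_distrib]
  have h1 := Fin.sum_univ_castSucc a
  have h2 := Fin.sum_univ_succ a
  linarith

/-- Splitting a guarded sum. [folklore] -/
theorem ite_add_zero_eq (c : Prop) [Decidable c] (a b : ℝ) :
    (if c then a + b else 0) = (if c then a else 0) + (if c then b else 0) := by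
  split_ifs <;> ring

/-- **(e) The Liouvillian decomposition of the Thomson witness** (`L ≥ 2`, `β ≥ 0`): pointwise
`X v = (p_0² − p_{L−1}²) + Σ_{bonds (i, j = i+1)} (p_i R_A + p_j R_B)` with the explicit `R_A` (free of `p_i`) and `R_B`
(free of `p_j`) of `poisson_bond`; `X = {H, ·}`, linearity over the bonds, telescoping. [folklore] -/
theorem liouvillian_thomsonWitness (hβ : 0 ≤ β) (hL : 2 ≤ L) (x : PhaseSpace L) :
    (pinnedChain ω₂ lam β γ).liouvillian L (fun y : PhaseSpace L => ∑ i : Fin L, ∑ j : Fin L, if j.val = i.val + 1 then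
      (y.2 i * (y.2 j ^ 2 * (-(6 * β * (y.1 j - y.1 i)) / (1 + 3 * β * (y.1 j - y.1 i) ^ 2) ^ 2) -
          partialQ j ((pinnedChain ω₂ lam β γ).hamiltonian L) y * (1 / (1 + 3 * β * (y.1 j - y.1 i) ^ 2))) +
        y.2 j * (y.2 i ^ 2 * (-(6 * β * (y.1 j - y.1 i)) / (1 + 3 * β * (y.1 j - y.1 i) ^ 2) ^ 2) +
          partialQ i ((pinnedChain ω₂ lam β γ).hamiltonian L) y * (1 / (1 + 3 * β * (y.1 j - y.1 i) ^ 2))))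
      else 0) x =
      (x.2 ⟨0, by omega⟩ ^ 2 - x.2 ⟨L - 1, by omega⟩ ^ 2) +
      ∑ i : Fin L, ∑ j : Fin L, if j.val = i.val + 1 then
        (x.2 i * (x.2 j * (x.2 j ^ 2 * (6 * β * (9 * β * (x.1 j - x.1 i) ^ 2 - 1) / (1 + 3 * β * (x.1 j - x.1 i) ^ 2) ^ 3) -
            partialQ j (partialQ j ((pinnedChain ω₂ lam β γ).hamiltonian L)) x * (1 / (1 + 3 * β * (x.1 j - x.1 i) ^ 2)) -
            3 * partialQ j ((pinnedChain ω₂ lam β γ).hamiltonian L) x * (-(6 * β * (x.1 j - x.1 i)) / (1 + 3 * β * (x.1 j - x.1 i) ^ 2) ^ 2)) +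
          (∑ k : Fin L, if k.val = j.val + 1 then x.2 k * (1 + 3 * β * (x.1 k - x.1 j) ^ 2) else 0) *
            (1 / (1 + 3 * β * (x.1 j - x.1 i) ^ 2))) +
        x.2 j * (x.2 i * (-(x.2 i ^ 2 * (6 * β * (9 * β * (x.1 j - x.1 i) ^ 2 - 1) / (1 + 3 * β * (x.1 j - x.1 i) ^ 2) ^ 3)) +
            partialQ i (partialQ i ((pinnedChain ω₂ lam β γ).hamiltonian L)) x * (1 / (1 + 3 * β * (x.1 j - x.1 i) ^ 2)) -
            3 * partialQ i ((pinnedChain ω₂ lam β γ).hamiltonian L) x * (-(6 * β * (x.1 j - x.1 i)) / (1 + 3 * β * (x.1 j - x.1 i) ^ 2) ^ 2)) -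
          (∑ k : Fin L, if i.val = k.val + 1 then x.2 k * (1 + 3 * β * (x.1 i - x.1 k) ^ 2) else 0) *
            (1 / (1 + 3 * β * (x.1 j - x.1 i) ^ 2))))
      else 0 := by
  rw [OscillatorChain.liouvillian_eq_poisson]
  have h1 := poisson_sum_right Finset.univ ((pinnedChain ω₂ lam β γ).hamiltonian L)
    (g := fun i y => ∑ j : Fin L, if j.val = i.val + 1 then
      (y.2 i * (y.2 j ^ 2 * (-(6 * β * (y.1 j - y.1 i)) / (1 + 3 * β * (y.1 j - y.1 i) ^ 2) ^ 2) -
          partialQ j ((pinnedChain ω₂ lam β γ).hamiltonian L) y * (1 / (1 + 3 * β * (y.1 j - y.1 i) ^ 2))) +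
        y.2 j * (y.2 i ^ 2 * (-(6 * β * (y.1 j - y.1 i)) / (1 + 3 * β * (y.1 j - y.1 i) ^ 2) ^ 2) +
          partialQ i ((pinnedChain ω₂ lam β γ).hamiltonian L) y * (1 / (1 + 3 * β * (y.1 j - y.1 i) ^ 2))))
      else 0)
    (fun i _ => Differentiable.fun_sum fun j _ => differentiable_bond_ite hβ i j) x
  have h2 : ∀ i : Fin L, poisson ((pinnedChain ω₂ lam β γ).hamiltonian L)
      (fun y : PhaseSpace L => ∑ j : Fin L, if j.val = i.val + 1 then
        (y.2 i * (y.2 j ^ 2 * (-(6 * β * (y.1 j - y.1 i)) / (1 + 3 * β * (y.1 j - y.1 i) ^ 2) ^ 2) -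
          partialQ j ((pinnedChain ω₂ lam β γ).hamiltonian L) y * (1 / (1 + 3 * β * (y.1 j - y.1 i) ^ 2))) +
        y.2 j * (y.2 i ^ 2 * (-(6 * β * (y.1 j - y.1 i)) / (1 + 3 * β * (y.1 j - y.1 i) ^ 2) ^ 2) +
          partialQ i ((pinnedChain ω₂ lam β γ).hamiltonian L) y * (1 / (1 + 3 * β * (y.1 j - y.1 i) ^ 2))))
        else 0) x = ∑ j : Fin L, poisson ((pinnedChain ω₂ lam β γ).hamiltonian L)
      (fun y : PhaseSpace L => if j.val = i.val + 1 then
        (y.2 i * (y.2 j ^ 2 * (-(6 * β * (y.1 j - y.1 i)) / (1 + 3 * β * (y.1 j - y.1 i) ^ 2) ^ 2) -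
          partialQ j ((pinnedChain ω₂ lam β γ).hamiltonian L) y * (1 / (1 + 3 * β * (y.1 j - y.1 i) ^ 2))) +
        y.2 j * (y.2 i ^ 2 * (-(6 * β * (y.1 j - y.1 i)) / (1 + 3 * β * (y.1 j - y.1 i) ^ 2) ^ 2) +
          partialQ i ((pinnedChain ω₂ lam β γ).hamiltonian L) y * (1 / (1 + 3 * β * (y.1 j - y.1 i) ^ 2))))
        else 0) x := fun i =>
    poisson_sum_right Finset.univ ((pinnedChain ω₂ lam β γ).hamiltonian L)
      (g := fun j y => if j.val = i.val + 1 then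
        (y.2 i * (y.2 j ^ 2 * (-(6 * β * (y.1 j - y.1 i)) / (1 + 3 * β * (y.1 j - y.1 i) ^ 2) ^ 2) -
          partialQ j ((pinnedChain ω₂ lam β γ).hamiltonian L) y * (1 / (1 + 3 * β * (y.1 j - y.1 i) ^ 2))) +
        y.2 j * (y.2 i ^ 2 * (-(6 * β * (y.1 j - y.1 i)) / (1 + 3 * β * (y.1 j - y.1 i) ^ 2) ^ 2) +
          partialQ i ((pinnedChain ω₂ lam β γ).hamiltonian L) y * (1 / (1 + 3 * β * (y.1 j - y.1 i) ^ 2))))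
        else 0)
      (fun j _ => differentiable_bond_ite hβ i j) x
  rw [h1, Finset.sum_congr rfl fun i _ => h2 i,
    Finset.sum_congr rfl fun i _ => Finset.sum_congr rfl fun j _ => poisson_bond_ite hβ i j x]
  simp only [ite_add_zero_eq _ (x.2 _ ^ 2 - x.2 _ ^ 2), Finset.sum_add_distrib]
  rw [sum_bond_sub_telescope (by omega) (fun m => x.2 m ^ 2)]

/-! ### The pattern identity `P₀ (X v) = p_0² − p_{L−1}²` -/

/-- `R_A` of the bond `(i, j = i+1)` does not depend on `p_i`. [folklore] -/
theorem restA_update_snd {i j : Fin L} (hj : j.val = i.val + 1) (y : PhaseSpace L) (t : ℝ) :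
    (((y.1, Function.update y.2 i t) : PhaseSpace L).2 j * (((y.1, Function.update y.2 i t) : PhaseSpace L).2 j ^ 2 * (6 * β * (9 * β * (((y.1, Function.update y.2 i t) : PhaseSpace L).1 j - ((y.1, Function.update y.2 i t) : PhaseSpace L).1 i) ^ 2 - 1) / (1 + 3 * β * (((y.1, Function.update y.2 i t) : PhaseSpace L).1 j - ((y.1, Function.update y.2 i t) : PhaseSpace L).1 i) ^ 2) ^ 3) -
            partialQ j (partialQ j ((pinnedChain ω₂ lam β γ).hamiltonian L)) ((y.1, Function.update y.2 i t) : PhaseSpace L) * (1 / (1 + 3 * β * (((y.1, Function.update y.2 i t) : PhaseSpace L).1 j - ((y.1, Function.update y.2 i t) : PhaseSpace L).1 i) ^ 2)) -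
            3 * partialQ j ((pinnedChain ω₂ lam β γ).hamiltonian L) ((y.1, Function.update y.2 i t) : PhaseSpace L) * (-(6 * β * (((y.1, Function.update y.2 i t) : PhaseSpace L).1 j - ((y.1, Function.update y.2 i t) : PhaseSpace L).1 i)) / (1 + 3 * β * (((y.1, Function.update y.2 i t) : PhaseSpace L).1 j - ((y.1, Function.update y.2 i t) : PhaseSpace L).1 i) ^ 2) ^ 2)) +
          (∑ k : Fin L, if k.val = j.val + 1 then ((y.1, Function.update y.2 i t) : PhaseSpace L).2 k * (1 + 3 * β * (((y.1, Function.update y.2 i t) : PhaseSpace L).1 k - ((y.1, Function.update y.2 i t) : PhaseSpace L).1 j) ^ 2) else 0) *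
            (1 / (1 + 3 * β * (((y.1, Function.update y.2 i t) : PhaseSpace L).1 j - ((y.1, Function.update y.2 i t) : PhaseSpace L).1 i) ^ 2))) =
    (y.2 j * (y.2 j ^ 2 * (6 * β * (9 * β * (y.1 j - y.1 i) ^ 2 - 1) / (1 + 3 * β * (y.1 j - y.1 i) ^ 2) ^ 3) -
            partialQ j (partialQ j ((pinnedChain ω₂ lam β γ).hamiltonian L)) y * (1 / (1 + 3 * β * (y.1 j - y.1 i) ^ 2)) -
            3 * partialQ j ((pinnedChain ω₂ lam β γ).hamiltonian L) y * (-(6 * β * (y.1 j - y.1 i)) / (1 + 3 * β * (y.1 j - y.1 i) ^ 2) ^ 2)) +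
          (∑ k : Fin L, if k.val = j.val + 1 then y.2 k * (1 + 3 * β * (y.1 k - y.1 j) ^ 2) else 0) *
            (1 / (1 + 3 * β * (y.1 j - y.1 i) ^ 2))) := by
  have hji : j ≠ i := fun e => by rw [e] at hj; omega
  have hsum : (∑ k : Fin L, if k.val = j.val + 1 then
      Function.update y.2 i t k * (1 + 3 * β * (y.1 k - y.1 j) ^ 2) else 0) =
      ∑ k : Fin L, if k.val = j.val + 1 then y.2 k * (1 + 3 * β * (y.1 k - y.1 j) ^ 2) else 0 :=
    Finset.sum_congr rfl fun k _ => by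
      split_ifs with hk
      · rw [Function.update_of_ne (fun e => by rw [e] at hk; omega)]
      · rfl
  simp only [partialQ_partialQ_hamiltonian_update_snd, partialQ_hamiltonian_update_snd, Function.update_of_ne hji,
    hsum]

/-- `R_B` of the bond `(i, j = i+1)` does not depend on `p_j`. [folklore] -/
theorem restB_update_snd {i j : Fin L} (hj : j.val = i.val + 1) (y : PhaseSpace L) (t : ℝ) :
    (((y.1, Function.update y.2 j t) : PhaseSpace L).2 i * (-(((y.1, Function.update y.2 j t) : PhaseSpace L).2 i ^ 2 * (6 * β * (9 * β * (((y.1, Function.update y.2 j t) : PhaseSpace L).1 j - ((y.1, Function.update y.2 j t) : PhaseSpace L).1 i) ^ 2 - 1) / (1 + 3 * β * (((y.1, Function.update y.2 j t) : PhaseSpace L).1 j - ((y.1, Function.update y.2 j t) : PhaseSpace L).1 i) ^ 2) ^ 3)) +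
            partialQ i (partialQ i ((pinnedChain ω₂ lam β γ).hamiltonian L)) ((y.1, Function.update y.2 j t) : PhaseSpace L) * (1 / (1 + 3 * β * (((y.1, Function.update y.2 j t) : PhaseSpace L).1 j - ((y.1, Function.update y.2 j t) : PhaseSpace L).1 i) ^ 2)) -
            3 * partialQ i ((pinnedChain ω₂ lam β γ).hamiltonian L) ((y.1, Function.update y.2 j t) : PhaseSpace L) * (-(6 * β * (((y.1, Function.update y.2 j t) : PhaseSpace L).1 j - ((y.1, Function.update y.2 j t) : PhaseSpace L).1 i)) / (1 + 3 * β * (((y.1, Function.update y.2 j t) : PhaseSpace L).1 j - ((y.1, Function.update y.2 j t) : PhaseSpace L).1 i) ^ 2) ^ 2)) -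
          (∑ k : Fin L, if i.val = k.val + 1 then ((y.1, Function.update y.2 j t) : PhaseSpace L).2 k * (1 + 3 * β * (((y.1, Function.update y.2 j t) : PhaseSpace L).1 i - ((y.1, Function.update y.2 j t) : PhaseSpace L).1 k) ^ 2) else 0) *
            (1 / (1 + 3 * β * (((y.1, Function.update y.2 j t) : PhaseSpace L).1 j - ((y.1, Function.update y.2 j t) : PhaseSpace L).1 i) ^ 2))) =
    (y.2 i * (-(y.2 i ^ 2 * (6 * β * (9 * β * (y.1 j - y.1 i) ^ 2 - 1) / (1 + 3 * β * (y.1 j - y.1 i) ^ 2) ^ 3)) +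
            partialQ i (partialQ i ((pinnedChain ω₂ lam β γ).hamiltonian L)) y * (1 / (1 + 3 * β * (y.1 j - y.1 i) ^ 2)) -
            3 * partialQ i ((pinnedChain ω₂ lam β γ).hamiltonian L) y * (-(6 * β * (y.1 j - y.1 i)) / (1 + 3 * β * (y.1 j - y.1 i) ^ 2) ^ 2)) -
          (∑ k : Fin L, if i.val = k.val + 1 then y.2 k * (1 + 3 * β * (y.1 i - y.1 k) ^ 2) else 0) *
            (1 / (1 + 3 * β * (y.1 j - y.1 i) ^ 2))) := by
  have hij : i ≠ j := fun e => by rw [e] at hj; omega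
  have hsum : (∑ k : Fin L, if i.val = k.val + 1 then
      Function.update y.2 j t k * (1 + 3 * β * (y.1 i - y.1 k) ^ 2) else 0) =
      ∑ k : Fin L, if i.val = k.val + 1 then y.2 k * (1 + 3 * β * (y.1 i - y.1 k) ^ 2) else 0 :=
    Finset.sum_congr rfl fun k _ => by
      split_ifs with hk
      · rw [Function.update_of_ne (fun e => by rw [e] at hk; omega)]
      · rfl
  simp only [partialQ_partialQ_hamiltonian_update_snd, partialQ_hamiltonian_update_snd, Function.update_of_ne hij,
    hsum]

/-- **(f) The pattern identity** (`L ≥ 2`, `β ≥ 0`): `P₀ (X v) = p_0² − p_{L−1}²` — by (e), the bath term is even in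
every momentum and `P₀ (p_i R_A) = P₀ (p_j R_B) = 0` (`patternAvg_snd_mul_eq_zero_of_indep`). [folklore] -/
theorem patternAvg_liouvillian_thomsonWitness (hβ : 0 ≤ β) (hL : 2 ≤ L) (x : PhaseSpace L) :
    (∑ σ : Fin L → Bool, (pinnedChain ω₂ lam β γ).liouvillian L (fun y : PhaseSpace L => ∑ i : Fin L, ∑ j : Fin L, if j.val = i.val + 1 then
      (y.2 i * (y.2 j ^ 2 * (-(6 * β * (y.1 j - y.1 i)) / (1 + 3 * β * (y.1 j - y.1 i) ^ 2) ^ 2) -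
          partialQ j ((pinnedChain ω₂ lam β γ).hamiltonian L) y * (1 / (1 + 3 * β * (y.1 j - y.1 i) ^ 2))) +
        y.2 j * (y.2 i ^ 2 * (-(6 * β * (y.1 j - y.1 i)) / (1 + 3 * β * (y.1 j - y.1 i) ^ 2) ^ 2) +
          partialQ i ((pinnedChain ω₂ lam β γ).hamiltonian L) y * (1 / (1 + 3 * β * (y.1 j - y.1 i) ^ 2))))
      else 0)
      (x.1, fun k => if σ k then -x.2 k else x.2 k)) / 2 ^ L =
      x.2 ⟨0, by omega⟩ ^ 2 - x.2 ⟨L - 1, by omega⟩ ^ 2 := by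
  rw [Finset.sum_congr rfl fun σ _ => liouvillian_thomsonWitness hβ hL _]
  rw [patternAvg_add (fun y : PhaseSpace L => y.2 ⟨0, by omega⟩ ^ 2 - y.2 ⟨L - 1, by omega⟩ ^ 2)
    (fun y : PhaseSpace L => ∑ i : Fin L, ∑ j : Fin L, if j.val = i.val + 1 then
        (y.2 i * (y.2 j * (y.2 j ^ 2 * (6 * β * (9 * β * (y.1 j - y.1 i) ^ 2 - 1) / (1 + 3 * β * (y.1 j - y.1 i) ^ 2) ^ 3) -
            partialQ j (partialQ j ((pinnedChain ω₂ lam β γ).hamiltonian L)) y * (1 / (1 + 3 * β * (y.1 j - y.1 i) ^ 2)) -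
            3 * partialQ j ((pinnedChain ω₂ lam β γ).hamiltonian L) y * (-(6 * β * (y.1 j - y.1 i)) / (1 + 3 * β * (y.1 j - y.1 i) ^ 2) ^ 2)) +
          (∑ k : Fin L, if k.val = j.val + 1 then y.2 k * (1 + 3 * β * (y.1 k - y.1 j) ^ 2) else 0) *
            (1 / (1 + 3 * β * (y.1 j - y.1 i) ^ 2))) +
        y.2 j * (y.2 i * (-(y.2 i ^ 2 * (6 * β * (9 * β * (y.1 j - y.1 i) ^ 2 - 1) / (1 + 3 * β * (y.1 j - y.1 i) ^ 2) ^ 3)) +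
            partialQ i (partialQ i ((pinnedChain ω₂ lam β γ).hamiltonian L)) y * (1 / (1 + 3 * β * (y.1 j - y.1 i) ^ 2)) -
            3 * partialQ i ((pinnedChain ω₂ lam β γ).hamiltonian L) y * (-(6 * β * (y.1 j - y.1 i)) / (1 + 3 * β * (y.1 j - y.1 i) ^ 2) ^ 2)) -
          (∑ k : Fin L, if i.val = k.val + 1 then y.2 k * (1 + 3 * β * (y.1 i - y.1 k) ^ 2) else 0) *
            (1 / (1 + 3 * β * (y.1 j - y.1 i) ^ 2))))
      else 0) x]
  have hE : ∀ (m : Fin L) (y : PhaseSpace L),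
      (momentumFlip m y).2 ⟨0, by omega⟩ ^ 2 - (momentumFlip m y).2 ⟨L - 1, by omega⟩ ^ 2 =
        y.2 ⟨0, by omega⟩ ^ 2 - y.2 ⟨L - 1, by omega⟩ ^ 2 := fun m y => by
    rw [momentumFlip_snd_sq, momentumFlip_snd_sq]
  rw [patternAvg_eq_self_of_forall_even
    (f := fun y : PhaseSpace L => y.2 ⟨0, by omega⟩ ^ 2 - y.2 ⟨L - 1, by omega⟩ ^ 2) hE x, add_eq_left]
  rw [patternAvg_finset_sum Finset.univ (fun (i : Fin L) (y : PhaseSpace L) =>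
    ∑ j : Fin L, if j.val = i.val + 1 then
        (y.2 i * (y.2 j * (y.2 j ^ 2 * (6 * β * (9 * β * (y.1 j - y.1 i) ^ 2 - 1) / (1 + 3 * β * (y.1 j - y.1 i) ^ 2) ^ 3) -
            partialQ j (partialQ j ((pinnedChain ω₂ lam β γ).hamiltonian L)) y * (1 / (1 + 3 * β * (y.1 j - y.1 i) ^ 2)) -
            3 * partialQ j ((pinnedChain ω₂ lam β γ).hamiltonian L) y * (-(6 * β * (y.1 j - y.1 i)) / (1 + 3 * β * (y.1 j - y.1 i) ^ 2) ^ 2)) +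
          (∑ k : Fin L, if k.val = j.val + 1 then y.2 k * (1 + 3 * β * (y.1 k - y.1 j) ^ 2) else 0) *
            (1 / (1 + 3 * β * (y.1 j - y.1 i) ^ 2))) +
        y.2 j * (y.2 i * (-(y.2 i ^ 2 * (6 * β * (9 * β * (y.1 j - y.1 i) ^ 2 - 1) / (1 + 3 * β * (y.1 j - y.1 i) ^ 2) ^ 3)) +
            partialQ i (partialQ i ((pinnedChain ω₂ lam β γ).hamiltonian L)) y * (1 / (1 + 3 * β * (y.1 j - y.1 i) ^ 2)) -
            3 * partialQ i ((pinnedChain ω₂ lam β γ).hamiltonian L) y * (-(6 * β * (y.1 j - y.1 i)) / (1 + 3 * β * (y.1 j - y.1 i) ^ 2) ^ 2)) -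
          (∑ k : Fin L, if i.val = k.val + 1 then y.2 k * (1 + 3 * β * (y.1 i - y.1 k) ^ 2) else 0) *
            (1 / (1 + 3 * β * (y.1 j - y.1 i) ^ 2))))
      else 0) x]
  refine Finset.sum_eq_zero fun i _ => ?_
  rw [patternAvg_finset_sum Finset.univ (fun (j : Fin L) (y : PhaseSpace L) =>
    if j.val = i.val + 1 then
        (y.2 i * (y.2 j * (y.2 j ^ 2 * (6 * β * (9 * β * (y.1 j - y.1 i) ^ 2 - 1) / (1 + 3 * β * (y.1 j - y.1 i) ^ 2) ^ 3) -
            partialQ j (partialQ j ((pinnedChain ω₂ lam β γ).hamiltonian L)) y * (1 / (1 + 3 * β * (y.1 j - y.1 i) ^ 2)) -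
            3 * partialQ j ((pinnedChain ω₂ lam β γ).hamiltonian L) y * (-(6 * β * (y.1 j - y.1 i)) / (1 + 3 * β * (y.1 j - y.1 i) ^ 2) ^ 2)) +
          (∑ k : Fin L, if k.val = j.val + 1 then y.2 k * (1 + 3 * β * (y.1 k - y.1 j) ^ 2) else 0) *
            (1 / (1 + 3 * β * (y.1 j - y.1 i) ^ 2))) +
        y.2 j * (y.2 i * (-(y.2 i ^ 2 * (6 * β * (9 * β * (y.1 j - y.1 i) ^ 2 - 1) / (1 + 3 * β * (y.1 j - y.1 i) ^ 2) ^ 3)) +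
            partialQ i (partialQ i ((pinnedChain ω₂ lam β γ).hamiltonian L)) y * (1 / (1 + 3 * β * (y.1 j - y.1 i) ^ 2)) -
            3 * partialQ i ((pinnedChain ω₂ lam β γ).hamiltonian L) y * (-(6 * β * (y.1 j - y.1 i)) / (1 + 3 * β * (y.1 j - y.1 i) ^ 2) ^ 2)) -
          (∑ k : Fin L, if i.val = k.val + 1 then y.2 k * (1 + 3 * β * (y.1 i - y.1 k) ^ 2) else 0) *
            (1 / (1 + 3 * β * (y.1 j - y.1 i) ^ 2))))
      else 0) x]
  refine Finset.sum_eq_zero fun j _ => ?_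
  by_cases hij : j.val = i.val + 1
  · rw [Finset.sum_congr rfl fun σ _ => if_pos hij]
    rw [patternAvg_add (fun y : PhaseSpace L => y.2 i * (y.2 j * (y.2 j ^ 2 * (6 * β * (9 * β * (y.1 j - y.1 i) ^ 2 - 1) / (1 + 3 * β * (y.1 j - y.1 i) ^ 2) ^ 3) -
            partialQ j (partialQ j ((pinnedChain ω₂ lam β γ).hamiltonian L)) y * (1 / (1 + 3 * β * (y.1 j - y.1 i) ^ 2)) -
            3 * partialQ j ((pinnedChain ω₂ lam β γ).hamiltonian L) y * (-(6 * β * (y.1 j - y.1 i)) / (1 + 3 * β * (y.1 j - y.1 i) ^ 2) ^ 2)) +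
          (∑ k : Fin L, if k.val = j.val + 1 then y.2 k * (1 + 3 * β * (y.1 k - y.1 j) ^ 2) else 0) *
            (1 / (1 + 3 * β * (y.1 j - y.1 i) ^ 2))))
      (fun y : PhaseSpace L => y.2 j * (y.2 i * (-(y.2 i ^ 2 * (6 * β * (9 * β * (y.1 j - y.1 i) ^ 2 - 1) / (1 + 3 * β * (y.1 j - y.1 i) ^ 2) ^ 3)) +
            partialQ i (partialQ i ((pinnedChain ω₂ lam β γ).hamiltonian L)) y * (1 / (1 + 3 * β * (y.1 j - y.1 i) ^ 2)) -
            3 * partialQ i ((pinnedChain ω₂ lam β γ).hamiltonian L) y * (-(6 * β * (y.1 j - y.1 i)) / (1 + 3 * β * (y.1 j - y.1 i) ^ 2) ^ 2)) -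
          (∑ k : Fin L, if i.val = k.val + 1 then y.2 k * (1 + 3 * β * (y.1 i - y.1 k) ^ 2) else 0) *
            (1 / (1 + 3 * β * (y.1 j - y.1 i) ^ 2)))) x,
      patternAvg_snd_mul_eq_zero_of_indep i (g := fun y : PhaseSpace L => (y.2 j * (y.2 j ^ 2 * (6 * β * (9 * β * (y.1 j - y.1 i) ^ 2 - 1) / (1 + 3 * β * (y.1 j - y.1 i) ^ 2) ^ 3) -
            partialQ j (partialQ j ((pinnedChain ω₂ lam β γ).hamiltonian L)) y * (1 / (1 + 3 * β * (y.1 j - y.1 i) ^ 2)) -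
            3 * partialQ j ((pinnedChain ω₂ lam β γ).hamiltonian L) y * (-(6 * β * (y.1 j - y.1 i)) / (1 + 3 * β * (y.1 j - y.1 i) ^ 2) ^ 2)) +
          (∑ k : Fin L, if k.val = j.val + 1 then y.2 k * (1 + 3 * β * (y.1 k - y.1 j) ^ 2) else 0) *
            (1 / (1 + 3 * β * (y.1 j - y.1 i) ^ 2))))
        (restA_update_snd hij) x,
      patternAvg_snd_mul_eq_zero_of_indep j (g := fun y : PhaseSpace L => (y.2 i * (-(y.2 i ^ 2 * (6 * β * (9 * β * (y.1 j - y.1 i) ^ 2 - 1) / (1 + 3 * β * (y.1 j - y.1 i) ^ 2) ^ 3)) +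
            partialQ i (partialQ i ((pinnedChain ω₂ lam β γ).hamiltonian L)) y * (1 / (1 + 3 * β * (y.1 j - y.1 i) ^ 2)) -
            3 * partialQ i ((pinnedChain ω₂ lam β γ).hamiltonian L) y * (-(6 * β * (y.1 j - y.1 i)) / (1 + 3 * β * (y.1 j - y.1 i) ^ 2) ^ 2)) -
          (∑ k : Fin L, if i.val = k.val + 1 then y.2 k * (1 + 3 * β * (y.1 i - y.1 k) ^ 2) else 0) *
            (1 / (1 + 3 * β * (y.1 j - y.1 i) ^ 2))))
        (restB_update_snd hij) x, add_zero]
  · rw [Finset.sum_congr rfl fun σ _ => if_neg hij]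
    simp

/-! ### `∂_{p_m}` of finite sums and of the guarded bond term -/

/-- `∂_{p_m}` of a finite sum of differentiable functions. [folklore] -/
theorem partialP_finset_sum {ι : Type*} (s : Finset ι) {g : ι → PhaseSpace L → ℝ}
    (hg : ∀ i ∈ s, Differentiable ℝ (g i)) (m : Fin L) (x : PhaseSpace L) :
    partialP m (fun y => ∑ i ∈ s, g i y) x = ∑ i ∈ s, partialP m (g i) x := by
  classical
  induction s using Finset.induction_on with
  | empty => simp
  | @insert a s ha ih =>
    have hga : Differentiable ℝ (g a) := hg a (Finset.mem_insert_self a s)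
    have hgs : ∀ i ∈ s, Differentiable ℝ (g i) := fun i hi => hg i (Finset.mem_insert_of_mem hi)
    have hsum : Differentiable ℝ (fun y => ∑ i ∈ s, g i y) := Differentiable.fun_sum fun i hi => hgs i hi
    simp only [Finset.sum_insert ha]
    rw [show (fun y => g a y + ∑ i ∈ s, g i y) = g a + fun y => ∑ i ∈ s, g i y from rfl,
      partialP_add hga hsum, ih hgs]

/-- `∂_{p_l}` of the guarded bond term: off the bonds it vanishes, on a bond it is `partialP_bond`. [folklore] -/
theorem partialP_bond_ite (i j l : Fin L) (x : PhaseSpace L) :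
    partialP l (fun y : PhaseSpace L => if j.val = i.val + 1 then
      (y.2 i * (y.2 j ^ 2 * (-(6 * β * (y.1 j - y.1 i)) / (1 + 3 * β * (y.1 j - y.1 i) ^ 2) ^ 2) -
          partialQ j ((pinnedChain ω₂ lam β γ).hamiltonian L) y * (1 / (1 + 3 * β * (y.1 j - y.1 i) ^ 2))) +
        y.2 j * (y.2 i ^ 2 * (-(6 * β * (y.1 j - y.1 i)) / (1 + 3 * β * (y.1 j - y.1 i) ^ 2) ^ 2) +
          partialQ i ((pinnedChain ω₂ lam β γ).hamiltonian L) y * (1 / (1 + 3 * β * (y.1 j - y.1 i) ^ 2))))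
      else 0) x =
      if j.val = i.val + 1 then
        ((if i = l then 1 else 0) * (x.2 j ^ 2 * (-(6 * β * (x.1 j - x.1 i)) / (1 + 3 * β * (x.1 j - x.1 i) ^ 2) ^ 2) -
          partialQ j ((pinnedChain ω₂ lam β γ).hamiltonian L) x * (1 / (1 + 3 * β * (x.1 j - x.1 i) ^ 2))) +
        (if j = l then 1 else 0) * (x.2 i ^ 2 * (-(6 * β * (x.1 j - x.1 i)) / (1 + 3 * β * (x.1 j - x.1 i) ^ 2) ^ 2) +
          partialQ i ((pinnedChain ω₂ lam β γ).hamiltonian L) x * (1 / (1 + 3 * β * (x.1 j - x.1 i) ^ 2))) +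
        (if j = l then 2 * x.2 j else 0) * (x.2 i * (-(6 * β * (x.1 j - x.1 i)) / (1 + 3 * β * (x.1 j - x.1 i) ^ 2) ^ 2)) +
        (if i = l then 2 * x.2 i else 0) * (x.2 j * (-(6 * β * (x.1 j - x.1 i)) / (1 + 3 * β * (x.1 j - x.1 i) ^ 2) ^ 2)))
      else 0 := by
  by_cases hij : j.val = i.val + 1
  · simp only [if_pos hij]
    exact partialP_bond i j l x
  · simp only [if_neg hij]
    exact partialP_const 0 l x

/-- Collapsing the bond sum of `∂_{p_m} (p_i G + p_j G')`: the Kronecker deltas select the (at most two) bonds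
through the site `m`. [folklore] -/
theorem sum_bond_partialP_collapse (m : Fin L) (x : PhaseSpace L) :
    ∑ i : Fin L, ∑ j : Fin L, (if j.val = i.val + 1 then
        ((if i = m then 1 else 0) * (x.2 j ^ 2 * (-(6 * β * (x.1 j - x.1 i)) / (1 + 3 * β * (x.1 j - x.1 i) ^ 2) ^ 2) -
          partialQ j ((pinnedChain ω₂ lam β γ).hamiltonian L) x * (1 / (1 + 3 * β * (x.1 j - x.1 i) ^ 2))) +
        (if j = m then 1 else 0) * (x.2 i ^ 2 * (-(6 * β * (x.1 j - x.1 i)) / (1 + 3 * β * (x.1 j - x.1 i) ^ 2) ^ 2) +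
          partialQ i ((pinnedChain ω₂ lam β γ).hamiltonian L) x * (1 / (1 + 3 * β * (x.1 j - x.1 i) ^ 2))) +
        (if j = m then 2 * x.2 j else 0) * (x.2 i * (-(6 * β * (x.1 j - x.1 i)) / (1 + 3 * β * (x.1 j - x.1 i) ^ 2) ^ 2)) +
        (if i = m then 2 * x.2 i else 0) * (x.2 j * (-(6 * β * (x.1 j - x.1 i)) / (1 + 3 * β * (x.1 j - x.1 i) ^ 2) ^ 2)))
      else 0) =
      ((∑ j : Fin L, if j.val = m.val + 1 then
          (x.2 j ^ 2 * (-(6 * β * (x.1 j - x.1 m)) / (1 + 3 * β * (x.1 j - x.1 m) ^ 2) ^ 2) -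
          partialQ j ((pinnedChain ω₂ lam β γ).hamiltonian L) x * (1 / (1 + 3 * β * (x.1 j - x.1 m) ^ 2))) else 0) +
        (∑ i : Fin L, if m.val = i.val + 1 then
          (x.2 i ^ 2 * (-(6 * β * (x.1 m - x.1 i)) / (1 + 3 * β * (x.1 m - x.1 i) ^ 2) ^ 2) +
          partialQ i ((pinnedChain ω₂ lam β γ).hamiltonian L) x * (1 / (1 + 3 * β * (x.1 m - x.1 i) ^ 2))) else 0)) +
        2 * x.2 m * ((∑ j : Fin L, if j.val = m.val + 1 then x.2 j * (-(6 * β * (x.1 j - x.1 m)) / (1 + 3 * β * (x.1 j - x.1 m) ^ 2) ^ 2) else 0) +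
          (∑ i : Fin L, if m.val = i.val + 1 then x.2 i * (-(6 * β * (x.1 m - x.1 i)) / (1 + 3 * β * (x.1 m - x.1 i) ^ 2) ^ 2) else 0)) := by
  have hpt : ∀ i j : Fin L, (if j.val = i.val + 1 then
        ((if i = m then 1 else 0) * (x.2 j ^ 2 * (-(6 * β * (x.1 j - x.1 i)) / (1 + 3 * β * (x.1 j - x.1 i) ^ 2) ^ 2) -
          partialQ j ((pinnedChain ω₂ lam β γ).hamiltonian L) x * (1 / (1 + 3 * β * (x.1 j - x.1 i) ^ 2))) +
        (if j = m then 1 else 0) * (x.2 i ^ 2 * (-(6 * β * (x.1 j - x.1 i)) / (1 + 3 * β * (x.1 j - x.1 i) ^ 2) ^ 2) +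
          partialQ i ((pinnedChain ω₂ lam β γ).hamiltonian L) x * (1 / (1 + 3 * β * (x.1 j - x.1 i) ^ 2))) +
        (if j = m then 2 * x.2 j else 0) * (x.2 i * (-(6 * β * (x.1 j - x.1 i)) / (1 + 3 * β * (x.1 j - x.1 i) ^ 2) ^ 2)) +
        (if i = m then 2 * x.2 i else 0) * (x.2 j * (-(6 * β * (x.1 j - x.1 i)) / (1 + 3 * β * (x.1 j - x.1 i) ^ 2) ^ 2)))
      else (0 : ℝ)) =
      (if i = m then (if j.val = i.val + 1 then
          (x.2 j ^ 2 * (-(6 * β * (x.1 j - x.1 i)) / (1 + 3 * β * (x.1 j - x.1 i) ^ 2) ^ 2) -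
          partialQ j ((pinnedChain ω₂ lam β γ).hamiltonian L) x * (1 / (1 + 3 * β * (x.1 j - x.1 i) ^ 2))) else 0) else 0) +
      (if j = m then (if j.val = i.val + 1 then
          (x.2 i ^ 2 * (-(6 * β * (x.1 j - x.1 i)) / (1 + 3 * β * (x.1 j - x.1 i) ^ 2) ^ 2) +
          partialQ i ((pinnedChain ω₂ lam β γ).hamiltonian L) x * (1 / (1 + 3 * β * (x.1 j - x.1 i) ^ 2))) else 0) else 0) +
      (if i = m then (if j.val = i.val + 1 then 2 * x.2 i * (x.2 j * (-(6 * β * (x.1 j - x.1 i)) / (1 + 3 * β * (x.1 j - x.1 i) ^ 2) ^ 2)) else 0) else 0) +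
      (if j = m then (if j.val = i.val + 1 then 2 * x.2 j * (x.2 i * (-(6 * β * (x.1 j - x.1 i)) / (1 + 3 * β * (x.1 j - x.1 i) ^ 2) ^ 2)) else 0) else 0) := by
    intro i j
    split_ifs <;> ring
  rw [Finset.sum_congr rfl fun i _ => Finset.sum_congr rfl fun j _ => hpt i j]
  have hA : (∑ i : Fin L, ∑ j : Fin L, if i = m then (if j.val = i.val + 1 then
          (x.2 j ^ 2 * (-(6 * β * (x.1 j - x.1 i)) / (1 + 3 * β * (x.1 j - x.1 i) ^ 2) ^ 2) -
          partialQ j ((pinnedChain ω₂ lam β γ).hamiltonian L) x * (1 / (1 + 3 * β * (x.1 j - x.1 i) ^ 2))) else 0) else (0 : ℝ)) =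
      ∑ j : Fin L, if j.val = m.val + 1 then
          (x.2 j ^ 2 * (-(6 * β * (x.1 j - x.1 m)) / (1 + 3 * β * (x.1 j - x.1 m) ^ 2) ^ 2) -
          partialQ j ((pinnedChain ω₂ lam β γ).hamiltonian L) x * (1 / (1 + 3 * β * (x.1 j - x.1 m) ^ 2))) else 0 := by
    rw [Finset.sum_comm]
    simp only [Finset.sum_ite_eq', Finset.mem_univ, if_true]
  have hB : (∑ i : Fin L, ∑ j : Fin L, if j = m then (if j.val = i.val + 1 then
          (x.2 i ^ 2 * (-(6 * β * (x.1 j - x.1 i)) / (1 + 3 * β * (x.1 j - x.1 i) ^ 2) ^ 2) +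
          partialQ i ((pinnedChain ω₂ lam β γ).hamiltonian L) x * (1 / (1 + 3 * β * (x.1 j - x.1 i) ^ 2))) else 0) else (0 : ℝ)) =
      ∑ i : Fin L, if m.val = i.val + 1 then
          (x.2 i ^ 2 * (-(6 * β * (x.1 m - x.1 i)) / (1 + 3 * β * (x.1 m - x.1 i) ^ 2) ^ 2) +
          partialQ i ((pinnedChain ω₂ lam β γ).hamiltonian L) x * (1 / (1 + 3 * β * (x.1 m - x.1 i) ^ 2))) else 0 := by
    simp only [Finset.sum_ite_eq', Finset.mem_univ, if_true]
  have hC : (∑ i : Fin L, ∑ j : Fin L, if i = m then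
        (if j.val = i.val + 1 then 2 * x.2 i * (x.2 j * (-(6 * β * (x.1 j - x.1 i)) / (1 + 3 * β * (x.1 j - x.1 i) ^ 2) ^ 2)) else 0) else (0 : ℝ)) =
      2 * x.2 m * (∑ j : Fin L, if j.val = m.val + 1 then x.2 j * (-(6 * β * (x.1 j - x.1 m)) / (1 + 3 * β * (x.1 j - x.1 m) ^ 2) ^ 2) else 0) := by
    rw [Finset.sum_comm]
    simp only [Finset.sum_ite_eq', Finset.mem_univ, if_true]
    rw [Finset.mul_sum]
    refine Finset.sum_congr rfl fun j _ => ?_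
    split_ifs <;> ring
  have hD : (∑ i : Fin L, ∑ j : Fin L, if j = m then
        (if j.val = i.val + 1 then 2 * x.2 j * (x.2 i * (-(6 * β * (x.1 j - x.1 i)) / (1 + 3 * β * (x.1 j - x.1 i) ^ 2) ^ 2)) else 0) else (0 : ℝ)) =
      2 * x.2 m * (∑ i : Fin L, if m.val = i.val + 1 then x.2 i * (-(6 * β * (x.1 m - x.1 i)) / (1 + 3 * β * (x.1 m - x.1 i) ^ 2) ^ 2) else 0) := by
    simp only [Finset.sum_ite_eq', Finset.mem_univ, if_true]
    rw [Finset.mul_sum]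
    refine Finset.sum_congr rfl fun i _ => ?_
    split_ifs <;> ring
  simp only [Finset.sum_add_distrib]
  rw [hA, hB, hC, hD]
  ring

/-! ### Registered helpers -/

/-- Registered helper sub-goal `helper_thomsonWitnessLiouvillian` of crux stmt-AtomisticToContinuum-11977 (line
`abel-storage-decay`, stub B `stub_bulkAbelGKPositivity`): the Liouvillian decomposition (e) of the Thomson witness
(`liouvillian_thomsonWitness`, restated notation-free). [folklore] -/
theorem helper_thomsonWitnessLiouvillian : ∀ (ω₂ lam β γ : ℝ), 0 ≤ β → ∀ (L : ℕ) (hL : 2 ≤ L) (x : Literature.MathematicalPhysics.KineticTheory.HeatConduction.PhaseSpace L), (Literature.MathematicalPhysics.KineticTheory.HeatConduction.pinnedChain ω₂ lam β γ).liouvillian L (fun y : Literature.MathematicalPhysics.KineticTheory.HeatConduction.PhaseSpace L => ∑ i : Fin L, ∑ j : Fin L, if j.val = i.val + 1 then (y.2 i * (y.2 j ^ 2 * (-(6 * β * (y.1 j - y.1 i)) / (1 + 3 * β * (y.1 j - y.1 i) ^ 2) ^ 2) - Literature.MathematicalPhysics.KineticTheory.HeatConduction.partialQ j ((Literature.MathematicalPhysics.KineticTheory.HeatConduction.pinnedChain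 ω₂ lam β γ).hamiltonian L) y * (1 / (1 + 3 * β * (y.1 j - y.1 i) ^ 2))) + y.2 j * (y.2 i ^ 2 * (-(6 * β * (y.1 j - y.1 i)) / (1 + 3 * β * (y.1 j - y.1 i) ^ 2) ^ 2) + Literature.MathematicalPhysics.KineticTheory.HeatConduction.partialQ i ((Literature.MathematicalPhysics.KineticTheory.HeatConduction.pinnedChain ω₂ lam β γ).hamiltonian L) y * (1 / (1 + 3 * β * (y.1 j - y.1 i) ^ 2)))) else 0) x = (x.2 ⟨0, by omega⟩ ^ 2 - x.2 ⟨L - 1, by omega⟩ ^ 2) + ∑ i : Fin L, ∑ j : Fin L, if j.val = i.val + 1 then (x.2 i * (x.2 j * (x.2 j ^ 2 * (6 * β * (9 * β * (x.1 j - x.1 i) ^ 2 - 1) / (1 + 3 * β * (x.1 j - x.1 i) ^ 2) ^ 3) - Literature.MathematicalPhysics.KineticTheory.HeatConduction.partialQ j (Literature.MathematicalPhysics.KineticTheory.HeatConduction.partialQ j ((Literature.MathematicalPhysics.KineticTheory.HeatConduction.pinnedChain ω₂ lam β γ).hamiltonian L)) x * (1 / (1 + 3 * β * (x.1 j - x.1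 i) ^ 2)) - 3 * Literature.MathematicalPhysics.KineticTheory.HeatConduction.partialQ j ((Literature.MathematicalPhysics.KineticTheory.HeatConduction.pinnedChain ω₂ lam β γ).hamiltonian L) x * (-(6 * β * (x.1 j - x.1 i)) / (1 + 3 * β * (x.1 j - x.1 i) ^ 2) ^ 2)) + (∑ k : Fin L, if k.val = j.val + 1 then x.2 k * (1 + 3 * β * (x.1 k - x.1 j) ^ 2) else 0) * (1 / (1 + 3 * β * (x.1 j - x.1 i) ^ 2))) + x.2 j * (x.2 i * (-(x.2 i ^ 2 * (6 * β * (9 * β * (x.1 j - x.1 i) ^ 2 - 1) / (1 + 3 * β * (x.1 j - x.1 i) ^ 2) ^ 3)) + Literature.MathematicalPhysics.KineticTheory.HeatConduction.partialQ i (Literature.MathematicalPhysics.KineticTheory.HeatConduction.partialQ i ((Literature.MathematicalPhysics.KineticTheory.HeatConduction.pinnedChain ω₂ lam β γ).hamiltonian L)) x * (1 / (1 + 3 * β * (x.1 j - x.1 i) ^ 2)) - 3 * Literature.MathematicalPhysics.KineticTheory.HeatConduction.partialQ i ((Literature.MathematicalPhysics.KineticTheory.HeatConduction.pinnedChain ω₂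 lam β γ).hamiltonian L) x * (-(6 * β * (x.1 j - x.1 i)) / (1 + 3 * β * (x.1 j - x.1 i) ^ 2) ^ 2)) - (∑ k : Fin L, if i.val = k.val + 1 then x.2 k * (1 + 3 * β * (x.1 i - x.1 k) ^ 2) else 0) * (1 / (1 + 3 * β * (x.1 j - x.1 i) ^ 2)))) else 0 :=
  fun _ _ _ _ hβ _ hL x => liouvillian_thomsonWitness hβ hL x

/-- Registered helper sub-goal `helper_thomsonWitnessPatternAvgLiouvillian` of crux stmt-AtomisticToContinuum-11977
(line `abel-storage-decay`, stub B `stub_bulkAbelGKPositivity`): the pattern identity (f) `P₀ (X v) = p_0² − p_{L−1}²`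
(`patternAvg_liouvillian_thomsonWitness`, restated notation-free). [folklore] -/
theorem helper_thomsonWitnessPatternAvgLiouvillian : ∀ (ω₂ lam β γ : ℝ), 0 ≤ β → ∀ (L : ℕ) (hL : 2 ≤ L) (x : Literature.MathematicalPhysics.KineticTheory.HeatConduction.PhaseSpace L), (∑ σ : Fin L → Bool, (Literature.MathematicalPhysics.KineticTheory.HeatConduction.pinnedChain ω₂ lam β γ).liouvillian L (fun y : Literature.MathematicalPhysics.KineticTheory.HeatConduction.PhaseSpace L => ∑ i : Fin L, ∑ j : Fin L, if j.val = i.val + 1 then (y.2 i * (y.2 j ^ 2 * (-(6 * β * (y.1 j - y.1 i)) / (1 + 3 * β * (y.1 j - y.1 i) ^ 2) ^ 2) - Literature.MathematicalPhysics.KineticTheory.HeatConduction.partialQ j ((Literature.MathematicalPhysics.KineticTheory.HeatConduction.pinnedChain ω₂ lam β γ).hamiltonian L) y * (1 / (1 + 3 * β * (y.1 j - y.1 i) ^ 2))) + y.2 j * (y.2 i ^ 2 * (-(6 * β * (y.1 j - y.1 i)) / (1 + 3 * β * (y.1 j - y.1 i) ^ 2) ^ 2) + Literature.MathematicalPhysics.KineticTheory.HeatConduction.partialQ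 i ((Literature.MathematicalPhysics.KineticTheory.HeatConduction.pinnedChain ω₂ lam β γ).hamiltonian L) y * (1 / (1 + 3 * β * (y.1 j - y.1 i) ^ 2)))) else 0) (x.1, fun k => if σ k then -x.2 k else x.2 k)) / 2 ^ L = x.2 ⟨0, by omega⟩ ^ 2 - x.2 ⟨L - 1, by omega⟩ ^ 2 :=
  fun _ _ _ _ hβ _ hL x => patternAvg_liouvillian_thomsonWitness hβ hL x

end Summit.AtomisticToContinuum.FouriersLaw.Theorems.NoisyFourier.ThomsonWitness.Algebra

end
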